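import Literature.AnabelianGeometry.AbsoluteAnabelian.AbsTopIII.BiAnabelianCompatibilityTeleDelta
import Literature.AnabelianGeometry.AbsoluteAnabelian.AbsTopIII.BiAnabelianNexusProofs
import Literature.AnabelianGeometry.AbsoluteAnabelian.AbsTopIII.BiAnabelianCompatibilityGlueShift
import Literature.AnabelianGeometry.AbsoluteAnabelian.AbsTopIII.FrobeniusPictureMLFShift

/-!
# [AbsTopIII] Cor. 3.7 (iii) second clause and (v) final sentence — ASSEMBLY from a glue family `K ⊇ K₁`

[cite: MochizukiAbsTopIII2015, Cor 3.7 (iii) p.88] [cite: MochizukiAbsTopIII2015, Cor 3.7 (v) p.88]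

abc-iut-L4-t5 (gen 6).  The discharge of the typed compatibility clauses of Cor. 3.7 is organised around ONE family
`K` on `𝒟*` that (a) contains the glue family `K₁ = glueFamily` (pairs through `𝔈` or through `𝒳`; it realises the
three cores AND the telecore family `𝒥`, `BiAnabelianCompatibilityGlue` / `…Telecore`) with the same homotopies and
(b) realises the `𝔖†_log` family along `𝒟†_{≤3} ↪ 𝒟*` — abc-iut-w5-d053's glue family `K₂` (row «COR37-LOGOBS-GLUE»,
`BiAnabelianLogGlue*`, under the `ι`-over-Galois hypotheses (H×), (Hlog)) is such a `K`.  This file records, for an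
ABSTRACT such `K`, everything that then follows, so that the closing theorems are one-liners:

* `realisesCoresAndLogObs_of_glueFamily_le`, `realisesCoresLogObsTele_of_glueFamily_le` — `K` realises the (iii)
  collection; `logObsCompat_of_glueFamily_le` — BOTH typed halves of (iii), second clause
  (`LogObsCompatCoresStmt`, `LogObsCompatTelecoreStmt`);
* `isShiftAction_shiftEquiv` — abc-iut-L4-t12's `Φ_m = shiftEquiv m` IS the `ℤ`-action of (v) (the body of t12's
  `shiftStmt`, with the witness exposed);
* `shiftCompatStmt'_of_glueFamily_le` — the successor statement `ShiftCompatStmt′ θ` of (v), final sentence, from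
  the `Φ_m`-compatibility of `K` and of the canonical shadow family `K'` (`realisesTeleDelta_shadowFamily`,
  `BiAnabelianCompatibilityTeleDelta`).

Remaining inputs (named, not proved here): `K₂ ⊇ K₁` + its `𝔖†_log` conjunct (w5-d053), the `Φ_m`-invariance of
`K₂` and of `K'`.  Proof-only; model-level bookkeeping; nothing here bears on [IUTchIII] Cor. 3.12.
-/

set_option autoImplicit false

namespace Literature.AnabelianGeometry.AbsoluteAnabelian

open _root_.CategoryTheory _root_.Quiver

universe u

namespace AbsTopIII.BiAnabelianSetting

open DiagramOfCategories

variable {X E N : Type u} [Category.{u} X] [Category.{u} E] [Category.{u} N]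
  (𝔖 : BiAnabelianSetting X E N) (θ : FiberSquare.BiAnabelianLift 𝔖.gal)

/-! ## The `ℤ`-action of (v) is `shiftEquiv` -/

/-- The identity 1-morphism of `𝒟*` has identity 2-cells (abc-iut-L4-t12's private lemma, restated).
[cite: MochizukiAbsTopIII2015, Definition 3.5 (v) p.76] -/
private theorem id_iso_app' : ∀ ⦃a b : Cor37Vertex⦄ (e : a ⟶ b) (x : 𝔖.starDiagram.obj a),
    ∃ h, ((OneMorphism.id 𝔖.starDiagram).iso e).hom.app x = eqToHom h := by
  intro a b e x
  exact ⟨rfl, by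
    simp only [OneMorphism.id, Iso.trans_hom, Iso.symm_hom, NatTrans.comp_app,
      Functor.leftUnitor_hom_app, Functor.rightUnitor_inv_app]
    erw [Category.comp_id]
    rfl⟩

/-- **abc-iut-L4-t12's `Φ_m = shiftEquiv m` IS the `ℤ`-action of Cor. 3.7 (v)** (the body of t12's `shiftStmt` with
the witness exposed: underlying graph maps the translations, nexus-classes, `Φ_0 ≅ id`, `Φ_m ∘ Φ_{m'} ≅ Φ_{m+m'}`).
[cite: MochizukiAbsTopIII2015, Cor 3.7 (v) p.88] -/
theorem isShiftAction_shiftEquiv : 𝔖.IsShiftAction 𝔖.shiftEquiv := by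
  refine ⟨fun m => rfl, 𝔖.shiftEquiv_isNexusClass, ⟨Cor37Vertex.shift_zero, ?_⟩,
    fun m m' => ⟨Cor37Vertex.shift_comp m m', ?_⟩⟩
  · exact OneMorphism.isomorphic_transport _ _ _ (𝔖.shiftApp_heq_id 0) (𝔖.shiftMor_iso_app 0) 𝔖.id_iso_app'
  · exact OneMorphism.isomorphic_transport _ _ _ (𝔖.shiftMor_comp_app_heq m m')
      (𝔖.shiftMor_comp_iso_app m m') (𝔖.shiftMor_iso_app (m + m'))

/-! ## From a family containing `K₁` and `𝔖†_log` -/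

section GlueLe

variable (K : 𝔖.starDiagram.HomotopyFamily)
  (hK : ∀ ⦃a b : Cor37Vertex⦄ ⦃P Q : Path a b⦄ (h : 𝔖.glueFamily.E P Q), ∃ h' : K.E P Q,
    𝔖.glueFamily.η h = K.η h')
  (hobs : ∃ H : 𝔖.logObsDiagram.HomotopyFamily, 𝔖.IsLogObservableFamily H ∧ H.CompatibleAlong embLog K)

include hK hobs

/-- **`K` realises the cores of (i), (ii) and `𝔖†_log`** (`RealisesCoresAndLogObs K`): the three core structures come
with `K₁` (`glueFamily_realises_cores_and_refCore`). [cite: MochizukiAbsTopIII2015, Cor 3.7 (iii) p.88] -/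
theorem realisesCoresAndLogObs_of_glueFamily_le : 𝔖.RealisesCoresAndLogObs K := by
  obtain ⟨⟨H₁, hH₁, hc₁, hK₁⟩, ⟨H₂, hH₂, hc₂, hK₂⟩, ⟨H₃, hH₃, hc₃, hK₃⟩⟩ :=
    𝔖.glueFamily_realises_cores_and_refCore
  exact ⟨hobs, ⟨H₁, hH₁, hc₁, hK₁.of_le hK⟩, ⟨H₂, hH₂, hc₂, hK₂.of_le hK⟩, ⟨H₃, hH₃, hc₃, hK₃.of_le hK⟩⟩

/-- **`K` realises the whole (iii) collection** (cores + `𝔖†_log` + the telecore family `𝒥` of `𝔗_δ`).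
[cite: MochizukiAbsTopIII2015, Cor 3.7 (iii) p.88] -/
theorem realisesCoresLogObsTele_of_glueFamily_le (θ : FiberSquare.BiAnabelianLift 𝔖.gal) :
    𝔖.RealisesCoresLogObsTele K :=
  ⟨𝔖.realisesCoresAndLogObs_of_glueFamily_le K hK hobs, 𝔖.refCoreFamily, 𝔖.refCoreFamily_terminal,
    𝔖.refCoreObs_isCore, 𝔖.teleT θ, 𝔖.teleT_isTelecoreDelta θ,
    (𝔖.teleJfam_compatibleAlong_glueFamily θ).of_le hK⟩

/-- **Both typed halves of Cor. 3.7 (iii), second clause**, from such a `K`. [cite: MochizukiAbsTopIII2015, Cor 3.7 (iii) p.88] -/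
theorem logObsCompat_of_glueFamily_le (θ : FiberSquare.BiAnabelianLift 𝔖.gal) :
    𝔖.LogObsCompatCoresStmt ∧ 𝔖.LogObsCompatTelecoreStmt :=
  (𝔖.realisesCoresLogObsTele_of_glueFamily_le K hK hobs θ).logObsCompat

/-- **Cor. 3.7 (v), final sentence (successor `ShiftCompatStmt′ θ`)** from such a `K`, given the `Φ_m`-compatibility
of `K` and of the canonical shadow family `K'` (which realises `𝔗_δ` and `ℋ_δ`, `realisesTeleDelta_shadowFamily`).
[cite: MochizukiAbsTopIII2015, Cor 3.7 (v) p.88] -/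
theorem shiftCompatStmt'_of_glueFamily_le
    (hKshift : ∀ m : ℤ, Nonempty ((𝔖.shiftEquiv m).hom.CompatibleWith K K))
    (hK'shift : ∀ m : ℤ, Nonempty ((𝔖.shiftEquiv m).hom.CompatibleWith
      ((𝔖.deltaShadow θ).shadowFamily (𝔖.deltaFF θ)) ((𝔖.deltaShadow θ).shadowFamily (𝔖.deltaFF θ)))) :
    𝔖.ShiftCompatStmt' θ :=
  ⟨𝔖.shiftEquiv, 𝔖.isShiftAction_shiftEquiv, ⟨K, 𝔖.realisesCoresLogObsTele_of_glueFamily_le K hK hobs θ, hKshift⟩,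
    ⟨_, 𝔖.realisesTeleDelta_shadowFamily θ, hK'shift⟩⟩

end GlueLe

/-! ## What `K₁` alone gives (every setting, no hypothesis) -/

/-- **The glue family `K₁` realises the (iii) collection EXCEPT `𝔖†_log`, and is `Φ_m`-compatible**; the canonical
shadow family realises `𝔗_δ` with `ℋ_δ` — the unconditional part of (v), final sentence, as a record.
[cite: MochizukiAbsTopIII2015, Cor 3.7 (v) p.88] -/
theorem shiftCompat_partial :
    (∀ m : ℤ, Nonempty ((𝔖.shiftEquiv m).hom.CompatibleWith 𝔖.glueFamily 𝔖.glueFamily)) ∧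
      ((∃ H hH, (𝔖.galCoreObs H hH).IsCore ∧ H.CompatibleAlong embGalCore 𝔖.glueFamily) ∧
        (∃ H hH, (𝔖.refCoreObs H hH).IsCore ∧ H.CompatibleAlong embRefCore 𝔖.glueFamily) ∧
        (∃ H hH, (𝔖.starGalCoreObs H hH).IsCore ∧ H.CompatibleAlong embStarCore 𝔖.glueFamily)) ∧
      (∃ H₁ hH₁ hc, ∃ T : (𝔖.daggerLe 1).Telecore (𝔖.refCoreObs H₁ hH₁) hc,
        𝔖.IsTelecoreDelta T ∧ T.Jfam.CompatibleAlong (embTele T) 𝔖.glueFamily) ∧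
      𝔖.RealisesTeleDelta θ ((𝔖.deltaShadow θ).shadowFamily (𝔖.deltaFF θ)) :=
  ⟨𝔖.compatibleWith_shiftEquiv_glueFamily, 𝔖.glueFamily_realises_cores_and_refCore,
    ⟨𝔖.refCoreFamily, 𝔖.refCoreFamily_terminal, 𝔖.refCoreObs_isCore, 𝔖.teleT θ, 𝔖.teleT_isTelecoreDelta θ,
      𝔖.teleJfam_compatibleAlong_glueFamily θ⟩,
    𝔖.realisesTeleDelta_shadowFamily θ⟩

end AbsTopIII.BiAnabelianSetting

end Literature.AnabelianGeometry.AbsoluteAnabelian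

-- tree-health (abc-iut-w6-d081 g5, 2026-08-26T21:00Z): comment-only re-land of a SKIPPED ACCEPT (accepted 19:06–19:14Z; serial farm import probe at 20:3xZ answers rc 75 «remote:stale:unbuilt» while the lane builds p90 < 2 min; dag tick #13 «> 60 min»);
-- declarations byte-identical to the accepted version; purpose = trigger the rebuild. No content change.
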